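import Summits.QuantumFields.BalabanUV.T4Continuum.Spine.NE9.DirectPairingApexAnalytic
import Mathlib.Analysis.SpecialFunctions.Trigonometric.Chebyshev.Basic
import Mathlib.Analysis.Calculus.Deriv.Polynomial

/-!
# T⁴ programme, spine estimate NE9 — THE RATE AT THE APEX, ANALYTIC CURRENCY: THE LOGARITHM IS NECESSARY (Chebyshev witness) — census item C46 of
# cell `pub-balaban-gaps`, seat ne9 (gen 15)

Cell `pub-balaban-gaps` (YM blitz G2, seat ne9, unit `pub-balaban-gaps-ne9-g15`; record `run/shared/lean/pub/pub-balaban-gaps/ne/NE9.md` §5 row C46).  Sequel to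
`DirectPairingApexAnalytic` (C45 (c), MODEL half: a function holomorphic near the real segment `[−l, l]`, bounded by `M` on the filled ellipse
`{l·cos z : ∣Im z∣ ≤ Y}` and by `η` ON the segment has `‖D′(0)‖ ≤ e·η·log(M∕η)∕(l·Y)` — `norm_deriv_le_log`; the Wilson-loop expectations inherit the King
route's generating-function rate up to that logarithm, `DirectPairingApexAnalyticScheme.expectAt_rate_of_king_analytic_log`).  QUESTION (C46): is the
logarithm an artefact of the three-lines route?  ANSWER (MODEL currency, this file): NO.  The Chebyshev polynomials are extremal for growth off a segment
(Bernstein–Walsh): `D_N(w) = η·T_N(w∕l)` has `D_N(l·cos z) = η·cos(N z)`, so `‖D_N‖ ≤ η` on the segment, `‖D_N‖ ≤ η·e^{N·Y} =: M` on the filled ellipse, and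
`‖D_N′(0)‖ = η·N∕l = η·log(M∕η)∕(l·Y)` for odd `N` — the bound of `norm_deriv_le_log` is ATTAINED UP TO THE ABSOLUTE FACTOR `e` along `M∕η = e^{NY} → ∞`,
and for EVERY ratio `M∕η ≥ e^{Y}` some odd `N` gives `‖D′(0)‖ ≥ η·(log(M∕η) − 2Y)∕(l·Y)`.  Consequently no «loss factor» `φ(M∕η)` replacing `e·log(M∕η)` in
`norm_deriv_le_log` can be sub-logarithmic: `φ(q) ≥ log q` at every `q = e^{(2m+1)Y}` (`log_le_lossFactor`).
* §1 the witness: `cheb_apply_mul_cos` (`T_N(cos z) = cos(Nz)`, Mathlib's `Polynomial.Chebyshev.T_complex_cos` BY NAME), `cheb_norm_le_on_strip`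
  (`‖cos w‖ ≤ e^{∣Im w∣}`), `cheb_norm_le_on_real`, `eval_U_zero` (`U_{N−1}(0) = sin(Nπ∕2)`, from `U_complex_cos`), `cheb_hasDerivAt_zero`
  (`D_N′(0) = η·N·sin(Nπ∕2)∕l`, `Polynomial.hasDerivAt` + `T_derivative_eq_U`), `norm_sin_odd_mul_pi_div_two`, `cheb_norm_deriv_zero` (`= η·N∕l`, `N` odd),
  `cheb_interp_sharp` (the three-lines step `norm_le_interp_ellipse` is itself saturated up to the factor `2`: `η·cosh(Ny) ≥ ½·η^{1−y∕Y}M^{y∕Y}`).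
* §2 the verdicts: `norm_deriv_le_log_sharp` (lattice form, equality `‖D′(0)‖ = η·log(M∕η)∕(l·Y)`), `norm_deriv_ge_floor` (every `M ≥ η·e^{Y}`),
  `log_le_lossFactor` (no sub-logarithmic loss factor).

SCOPE OF THE VERDICT.  This settles the MODEL currency — the hypothesis list of `norm_deriv_le_log` verbatim.  In the SCHEME currency of
`DirectPairingApexAnalyticScheme` the functions `D` are differences of complex cumulant generating functions of observables bounded by `1` (Laplace transforms
of measures on a bounded interval), a proper sub-class; whether that extra structure removes the logarithm is NOT settled here (analysis of record in NE9.md row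
C46: prescribing the first `N` moments of a bounded signed density realises a Chebyshev profile up to a tail, at total-variation cost `e^{O(N log N)}`, so the
measure structure can gain at most a `log log` — not typed; no consumer).  NOTHING new is owed by the E-side; CLASSIFICATION OF NE9 UNCHANGED: WORK-bound (W1 =
the one-step renormalization transformation as a Lean object; instance 0∕1).

HONEST FRAMING: MODEL-level complex analysis on hypothesis SHAPES (label MODEL) for rung (B)+1 bookkeeping on ONE FIXED finite four-torus; NO definition; no
statement about Bałaban's d = 4 procedure is made here; NE9 NOT PRINTED ∕ NOT PROVED; spine PROVED 0∕9 unchanged; instance 0∕1; NOT UV stability, NOT the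
continuum limit, NOT infinite volume, NOT a mass gap, NOT Clay.

References (TYPES only): the extremality of `T_N` off the segment is the classical Bernstein–Walsh lemma (e.g. E. B. Saff, *Logarithmic potential theory with
applications to approximation theory*, arXiv:1010.3760, §1; D. Gaier, *Lectures on Complex Approximation* (1987) Ch. IV) — no statement of theirs is asserted;
Mathlib's Chebyshev API (`T_complex_cos`, `U_complex_cos`, `T_derivative_eq_U`) and `Polynomial.hasDerivAt` consumed BY NAME.
-/

namespace Summit.QuantumFields.BalabanUV.T4Continuum.NE9.DirectPairingApexAnalyticSharp

open Complex Set Filter Topology Metric Polynomial Polynomial.Chebyshev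
open scoped Real

/-! ## §1 The Chebyshev witness `D_N(w) = η·T_N(w∕l)` -/

section Witness

variable {η l Y : ℝ}

/-- **ON THE ELLIPSE PARAMETRISATION THE WITNESS IS `η·cos(Nz)`**: `η·T_N((l·cos z)∕l) = η·cos(N z)` (`l ≠ 0`; Mathlib's `T_complex_cos`). [folklore] -/
theorem cheb_apply_mul_cos (hl : l ≠ 0) (η : ℝ) (N : ℕ) (z : ℂ) :
    (η : ℂ) * (T ℂ N).eval ((l : ℂ) * Complex.cos z / l) = η * Complex.cos (N * z) := by
  have hl' : (l : ℂ) ≠ 0 := Complex.ofReal_ne_zero.mpr hl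
  rw [mul_div_cancel_left₀ _ hl', T_complex_cos]
  push_cast
  ring_nf

/-- **THE BOUND ON THE FILLED ELLIPSE**: for `∣Im z∣ ≤ Y` and `0 ≤ η`, `‖η·T_N(cos z)‖ ≤ η·e^{N·Y}` (`‖cos w‖ ≤ cosh(Im w) ≤ e^{∣Im w∣}`, re-derived
inline — the tree has this estimate under several topic-foreign modules). [folklore] -/
theorem cheb_norm_le_on_strip (hl : l ≠ 0) (hη : 0 ≤ η) (N : ℕ) {z : ℂ} (hz : |z.im| ≤ Y) :
    ‖(η : ℂ) * (T ℂ N).eval ((l : ℂ) * Complex.cos z / l)‖ ≤ η * Real.exp (N * Y) := by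
  rw [cheb_apply_mul_cos hl, norm_mul, Complex.norm_real, Real.norm_eq_abs, abs_of_nonneg hη]
  have hcos : ∀ w : ℂ, ‖Complex.cos w‖ ≤ Real.exp |w.im| := fun w => by
    have h := norm_add_le (Complex.exp (w * I)) (Complex.exp (-w * I))
    rw [← Complex.two_cos, norm_mul, Complex.norm_two, Complex.norm_exp, Complex.norm_exp] at h
    have e1 : (w * I).re = -w.im := by simp
    have e2 : (-w * I).re = w.im := by simp
    rw [e1, e2] at h
    have h1 : Real.exp (-w.im) ≤ Real.exp |w.im| := Real.exp_le_exp.mpr (neg_le_abs _)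
    have h2 : Real.exp w.im ≤ Real.exp |w.im| := Real.exp_le_exp.mpr (le_abs_self _)
    linarith
  refine mul_le_mul_of_nonneg_left ((hcos _).trans ?_) hη
  have him : ((N : ℂ) * z).im = N * z.im := by simp [mul_im]
  rw [him, abs_mul, Nat.abs_cast]
  exact Real.exp_le_exp.mpr (mul_le_mul_of_nonneg_left hz N.cast_nonneg)

/-- **THE BOUND ON THE SEGMENT**: for real `x` and `0 ≤ η`, `‖η·T_N(cos x)‖ = η·∣cos(Nx)∣ ≤ η`. [folklore] -/
theorem cheb_norm_le_on_real (hl : l ≠ 0) (hη : 0 ≤ η) (N : ℕ) (x : ℝ) :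
    ‖(η : ℂ) * (T ℂ N).eval ((l : ℂ) * Complex.cos x / l)‖ ≤ η := by
  rw [cheb_apply_mul_cos hl, norm_mul, Complex.norm_real, Real.norm_eq_abs, abs_of_nonneg hη]
  have e : (N : ℂ) * (x : ℂ) = ((N * x : ℝ) : ℂ) := by push_cast; ring
  rw [e, ← Complex.ofReal_cos, Complex.norm_real, Real.norm_eq_abs]
  nlinarith [Real.abs_cos_le_one (N * x)]

/-- `U_{N−1}(0) = sin(N·π∕2)` (Mathlib's `U_complex_cos` at `θ = π∕2`). [folklore] -/
theorem eval_U_zero (N : ℕ) : (U ℂ ((N : ℤ) - 1)).eval 0 = Complex.sin (N * (π / 2)) := by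
  have h := U_complex_cos (π / 2 : ℂ) ((N : ℤ) - 1)
  rw [Complex.cos_pi_div_two, Complex.sin_pi_div_two, mul_one] at h
  rw [h]
  push_cast
  ring_nf

/-- **THE DERIVATIVE AT THE CENTRE**: `D_N′(0) = η·N·sin(Nπ∕2)∕l` (`Polynomial.hasDerivAt`, `T_derivative_eq_U`, `eval_U_zero`). [folklore] -/
theorem cheb_hasDerivAt_zero (hl : l ≠ 0) (η : ℝ) (N : ℕ) :
    HasDerivAt (fun w : ℂ => (η : ℂ) * (T ℂ N).eval (w / l))
      ((η : ℂ) * ((N : ℂ) * Complex.sin (N * (π / 2)) * (1 / l))) 0 := by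
  have hl' : (l : ℂ) ≠ 0 := Complex.ofReal_ne_zero.mpr hl
  have hg : HasDerivAt (fun w : ℂ => w / l) (1 / (l : ℂ)) 0 := by
    simpa using (hasDerivAt_id (0 : ℂ)).div_const (l : ℂ)
  have hp : HasDerivAt (fun x : ℂ => (T ℂ N).eval x) (((T ℂ (N : ℤ)).derivative).eval ((0 : ℂ) / l)) ((0 : ℂ) / l) :=
    (T ℂ (N : ℤ)).hasDerivAt _
  have hcomp := (hp.comp 0 hg).const_mul (η : ℂ)
  have hval : ((T ℂ (N : ℤ)).derivative).eval ((0 : ℂ) / l) = (N : ℂ) * Complex.sin (N * (π / 2)) := by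
    rw [zero_div, T_derivative_eq_U, eval_mul, eval_intCast, eval_U_zero]
    push_cast
    ring
  rw [hval] at hcomp
  exact hcomp

/-- `‖sin((2m+1)·π∕2)‖ = 1`. [folklore] -/
theorem norm_sin_odd_mul_pi_div_two (m : ℕ) : ‖Complex.sin (((2 * m + 1 : ℕ) : ℂ) * (π / 2))‖ = 1 := by
  have e : (((2 * m + 1 : ℕ) : ℂ) * (π / 2)) = (((m : ℝ) * Real.pi + Real.pi / 2 : ℝ) : ℂ) := by
    push_cast
    ring
  rw [e, ← Complex.ofReal_sin, Complex.norm_real, Real.norm_eq_abs, Real.sin_add_pi_div_two]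
  exact_mod_cast Real.abs_cos_int_mul_pi (m : ℤ)

/-- **`‖D_N′(0)‖ = η·N∕l` for odd `N = 2m+1`** (`0 ≤ η`, `0 < l`). [folklore] -/
theorem cheb_norm_deriv_zero (hl : 0 < l) (hη : 0 ≤ η) (m : ℕ) :
    ‖deriv (fun w : ℂ => (η : ℂ) * (T ℂ ((2 * m + 1 : ℕ) : ℤ)).eval (w / l)) 0‖ = η * (2 * m + 1 : ℕ) / l := by
  rw [(cheb_hasDerivAt_zero hl.ne' η (2 * m + 1)).deriv, norm_mul, norm_mul, norm_mul, Complex.norm_real, Complex.norm_natCast,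
    norm_sin_odd_mul_pi_div_two, norm_div, norm_one, Complex.norm_real, Real.norm_eq_abs, Real.norm_eq_abs, abs_of_nonneg hη,
    abs_of_pos hl]
  ring

/-- **THE THREE-LINES STEP IS ITSELF SHARP (up to the factor `2`)**: on the imaginary axis of the parametrisation the witness saturates
`DirectPairingApexAnalytic.norm_le_interp_ellipse` — `‖D_N(l·cos(iy))‖ = η·cosh(Ny) ≥ ½·η^{1−y∕Y}·M^{y∕Y}` with `M = η·e^{NY}` (`0 < η`, `0 < Y`). [folklore] -/
theorem cheb_interp_sharp (hl : l ≠ 0) (hη : 0 < η) (hY : 0 < Y) (N : ℕ) (y : ℝ) :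
    (1 / 2 : ℝ) * (η ^ (1 - y / Y) * (η * Real.exp (N * Y)) ^ (y / Y)) ≤
      ‖(η : ℂ) * (T ℂ N).eval ((l : ℂ) * Complex.cos ((y : ℂ) * I) / l)‖ := by
  rw [cheb_apply_mul_cos hl, norm_mul, Complex.norm_real, Real.norm_eq_abs, abs_of_pos hη]
  have e : (N : ℂ) * ((y : ℂ) * I) = ((N * y : ℝ) : ℂ) * I := by push_cast; ring
  rw [e, Complex.cos_mul_I, ← Complex.ofReal_cosh, Complex.norm_real, Real.norm_eq_abs,
    abs_of_pos (Real.cosh_pos _)]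
  -- the interpolation value is `η·e^{Ny}`
  have hYne : Y ≠ 0 := hY.ne'
  have hval : η ^ (1 - y / Y) * (η * Real.exp (N * Y)) ^ (y / Y) = η * Real.exp (N * y) := by
    rw [Real.mul_rpow hη.le (Real.exp_pos _).le, ← Real.exp_mul, ← mul_assoc, ← Real.rpow_add hη, sub_add_cancel,
      Real.rpow_one]
    congr 2
    field_simp
  rw [hval, Real.cosh_eq]
  have h0 : 0 ≤ Real.exp (-(N * y)) := (Real.exp_pos _).le
  nlinarith [hη]

/-- The witness is entire. [folklore] -/
theorem cheb_differentiable (η l : ℝ) (N : ℕ) : Differentiable ℂ (fun w : ℂ => (η : ℂ) * (T ℂ N).eval (w / l)) := by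
  have h1 : Differentiable ℂ (fun w : ℂ => (T ℂ (N : ℤ)).eval (w / l)) :=
    (T ℂ (N : ℤ)).differentiable.comp (differentiable_id.div_const _)
  exact h1.const_mul _

end Witness

/-! ## §2 The verdicts: the logarithm of `norm_deriv_le_log` is necessary -/

section Verdict

variable {η l Y : ℝ}

/-- **`norm_deriv_le_log` IS SHARP UP TO THE FACTOR `e` (lattice form).**  For `0 < l`, `0 < Y`, `0 < η` and every `m`, with `N = 2m+1` and `M = η·e^{NY}`:
the entire function `D = η·T_N(·∕l)` satisfies EVERY hypothesis of `DirectPairingApexAnalytic.norm_deriv_le_log` (with `U = univ`): `‖D(l·cos z)‖ ≤ M` for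
`∣Im z∣ ≤ Y`, `‖D(l·cos x)‖ ≤ η` for real `x`; `log(M∕η) = N·Y`; and `‖D′(0)‖ = η·log(M∕η)∕(l·Y)` EXACTLY — `e⁻¹` times the upper bound `e·η·log(M∕η)∕(l·Y)`,
along `M∕η = e^{(2m+1)Y} → ∞`.  MODEL-level. [folklore] -/
theorem norm_deriv_le_log_sharp (hl : 0 < l) (hY : 0 < Y) (hη : 0 < η) (m : ℕ) :
    ∃ (D : ℂ → ℂ) (M : ℝ), Differentiable ℂ D ∧
      (∀ z : ℂ, |z.im| ≤ Y → ‖D ((l : ℂ) * Complex.cos z)‖ ≤ M) ∧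
      (∀ x : ℝ, ‖D ((l : ℂ) * Complex.cos x)‖ ≤ η) ∧
      Real.log (M / η) = (2 * m + 1 : ℕ) * Y ∧
      ‖deriv D 0‖ = η * Real.log (M / η) / (l * Y) := by
  set N : ℕ := 2 * m + 1 with hN
  refine ⟨fun w : ℂ => (η : ℂ) * (T ℂ (N : ℤ)).eval (w / l), η * Real.exp (N * Y), cheb_differentiable η l N,
    fun z hz => cheb_norm_le_on_strip hl.ne' hη.le N hz, fun x => cheb_norm_le_on_real hl.ne' hη.le N x, ?_, ?_⟩
  · rw [mul_div_cancel_left₀ _ hη.ne', Real.log_exp]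
  · rw [mul_div_cancel_left₀ _ hη.ne', Real.log_exp, hN, cheb_norm_deriv_zero hl hη.le m]
    field_simp

/-- **… FOR EVERY ADMISSIBLE RATIO (floor form).**  For `0 < l`, `0 < Y`, `0 < η` and EVERY `M` with `η·e^{Y} ≤ M` there is an entire `D` with
`‖D(l·cos z)‖ ≤ M` on `∣Im z∣ ≤ Y`, `‖D(l·cos x)‖ ≤ η` on the reals, and `‖D′(0)‖ ≥ η·(log(M∕η) − 2Y)∕(l·Y)` (take the largest odd `N` with `N·Y ≤ log(M∕η)`).
MODEL-level. [folklore] -/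
theorem norm_deriv_ge_floor (hl : 0 < l) (hY : 0 < Y) (hη : 0 < η) {M : ℝ} (hM : η * Real.exp Y ≤ M) :
    ∃ D : ℂ → ℂ, Differentiable ℂ D ∧
      (∀ z : ℂ, |z.im| ≤ Y → ‖D ((l : ℂ) * Complex.cos z)‖ ≤ M) ∧
      (∀ x : ℝ, ‖D ((l : ℂ) * Complex.cos x)‖ ≤ η) ∧
      η * (Real.log (M / η) - 2 * Y) / (l * Y) ≤ ‖deriv D 0‖ := by
  -- `q = log(M∕η)∕Y ≥ 1`; `m = ⌊(q − 1)∕2⌋₊`, `N = 2m+1 ∈ ]q − 2, q]`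
  have hMpos : 0 < M := lt_of_lt_of_le (mul_pos hη (Real.exp_pos Y)) hM
  set q : ℝ := Real.log (M / η) / Y with hq
  have hq1 : 1 ≤ q := by
    rw [hq, le_div_iff₀ hY, one_mul, ← Real.log_exp Y]
    exact Real.log_le_log (Real.exp_pos Y) (by rw [le_div_iff₀ hη, mul_comm]; exact hM)
  set m : ℕ := ⌊(q - 1) / 2⌋₊ with hm
  have hm0 : (0 : ℝ) ≤ (q - 1) / 2 := by linarith
  have hmle : (m : ℝ) ≤ (q - 1) / 2 := Nat.floor_le hm0
  have hmgt : (q - 1) / 2 < m + 1 := Nat.lt_floor_add_one _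
  have hNle : ((2 * m + 1 : ℕ) : ℝ) * Y ≤ Real.log (M / η) := by
    have : ((2 * m + 1 : ℕ) : ℝ) ≤ q := by push_cast; linarith
    have h := mul_le_mul_of_nonneg_right this hY.le
    rwa [hq, div_mul_cancel₀ _ hY.ne'] at h
  have hNge : q - 2 ≤ ((2 * m + 1 : ℕ) : ℝ) := by push_cast; linarith
  refine ⟨fun w : ℂ => (η : ℂ) * (T ℂ ((2 * m + 1 : ℕ) : ℤ)).eval (w / l), cheb_differentiable η l _, fun z hz => ?_,
    fun x => cheb_norm_le_on_real hl.ne' hη.le _ x, ?_⟩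
  · refine (cheb_norm_le_on_strip hl.ne' hη.le _ hz).trans ?_
    calc η * Real.exp (((2 * m + 1 : ℕ) : ℝ) * Y) ≤ η * Real.exp (Real.log (M / η)) :=
          mul_le_mul_of_nonneg_left (Real.exp_le_exp.mpr hNle) hη.le
      _ = M := by rw [Real.exp_log (div_pos hMpos hη)]; field_simp
  · rw [cheb_norm_deriv_zero hl hη.le m]
    have e : η * (Real.log (M / η) - 2 * Y) / (l * Y) = η * (q - 2) / l := by
      rw [hq]
      field_simp
    rw [e, div_le_div_iff_of_pos_right hl]
    exact mul_le_mul_of_nonneg_left hNge hη.le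

/-- **NO SUB-LOGARITHMIC LOSS FACTOR.**  If `φ` is ANY function such that every entire `D` with `‖D(l·cos z)‖ ≤ M` on `∣Im z∣ ≤ Y`, `‖D(l·cos x)‖ ≤ η` on the
reals, `0 < η`, `e·η ≤ M` obeys `‖D′(0)‖ ≤ η·φ(M∕η)∕(l·Y)` (the landed `norm_deriv_le_log` says `φ = e·log` qualifies), then `φ(q) ≥ log q` at every lattice
ratio `q = e^{(2m+1)Y}` with `(2m+1)Y ≥ 1`.  MODEL-level. [folklore] -/
theorem log_le_lossFactor (hl : 0 < l) (hY : 0 < Y) {φ : ℝ → ℝ}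
    (hφ : ∀ (D : ℂ → ℂ) (M η : ℝ), Differentiable ℂ D → 0 < η → Real.exp 1 * η ≤ M →
      (∀ z : ℂ, |z.im| ≤ Y → ‖D ((l : ℂ) * Complex.cos z)‖ ≤ M) → (∀ x : ℝ, ‖D ((l : ℂ) * Complex.cos x)‖ ≤ η) →
        ‖deriv D 0‖ ≤ η * φ (M / η) / (l * Y))
    {m : ℕ} (hm : 1 ≤ (2 * m + 1 : ℕ) * Y) :
    (2 * m + 1 : ℕ) * Y ≤ φ (Real.exp ((2 * m + 1 : ℕ) * Y)) := by
  obtain ⟨D, M, hD, hM, hη, hlog, hderiv⟩ := norm_deriv_le_log_sharp hl hY one_pos m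
  rw [div_one] at hlog hderiv
  have hMeq : M = Real.exp ((2 * m + 1 : ℕ) * Y) := by
    have hMpos : 0 < M := by
      have h0 := hM 0 (by rw [Complex.zero_im, abs_zero]; exact hY.le)
      by_contra hneg
      have hMle : M ≤ 0 := le_of_not_gt hneg
      -- if `M ≤ 0` then `log M ≤ 0 < (2m+1)Y`
      have : Real.log M ≤ 0 := Real.log_nonpos ((norm_nonneg _).trans h0) (by linarith)
      have hpos : 0 < ((2 * m + 1 : ℕ) : ℝ) * Y := by positivity
      linarith
    rw [← hlog, Real.exp_log hMpos]
  have heM : Real.exp 1 * 1 ≤ M := by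
    rw [mul_one, hMeq]
    exact Real.exp_le_exp.mpr hm
  have key := hφ D M 1 hD one_pos heM hM hη
  rw [hderiv, one_mul, one_mul, div_one] at key
  have key' : Real.log M ≤ φ M := (div_le_div_iff_of_pos_right (mul_pos hl hY)).mp key
  rw [hlog, hMeq] at key'
  exact key'

end Verdict

end Summit.QuantumFields.BalabanUV.T4Continuum.NE9.DirectPairingApexAnalyticSharp
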